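import Mathlib
import Summits.ResolutionOfSingularities.ResolutionOfSingularities.Theorems.WeightedInvariantLocalWeightedDropTOT2CurveConflictDivTwo

/-!
# `LocalWeightedDrop`, NC count game — TOT2-LINE piece S-CRV (v1.1 (D)), part 4: OTHER graph branches under the GRAPH-CURVE MOVE (fact F7)

[OURS · L1 W4.3 · chain w43, engine crux `LocalWeightedDrop` stmt-ResolutionOfSingularities-8899; sub-line under the v32 registered stub
`stub_spaceNCRankDrop`, design memo `L/res-L1-w43-lead-1/g4/TOT2-LINE.md` v1.1 ADDENDUM (D); piece S-CRV = res-type-088 (res-L1-w43-plan-1 DEALS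
gen 10 #9); `--supports 8899 --as helper`, counted 0; definition-free; nothing here is a statement of any manuscript; AI-written (gate-accepted =
sorry-free with standard axioms, not refereed).]

succT's third case (the GRAPH-CURVE MOVE M3) blows up the graph curve `V(y + ψ, u₂ + u₁h)`: transport `divTwoT d (prep d (shearT h A))`.  This part
tracks a SECOND graph branch `V(y + ψ₂, u₂ + u₁h₂)`, `h₂ ≠ h`, through that move — completing, with parts 1–3 (F1–F6), the table «graph branch ↦ its
datum at the near point» for every label transport of `PolyDescent.succT`:
* `isPermissibleTwoT_graph_reshear` — in the coordinates sheared by `h` the second branch has datum `h₂ − h` (`MonicDescent.shear_shear_of_noY`);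
* **`graph_graphMove`** (F7) — after the move the second branch is a permissible graph branch of the new label with datum `h₂ − h ≠ 0`: it is
  tangent to (or transverse to) the new boundary letter with contact `1 + ord (h₂ − h)` = the old contact order of the two branches — the second
  way a B-permissibility conflict is BORN on-strategy (F2 for the preparing re-centring, then F6);
* `hasGraphCurveT_graphMove` — the same for the predicate `HasGraphCurveT`.
The preparing re-centring `ψ₀` is taken as data (`ψ₀(0) = 0`, the re-centred sheared label a position with `V(y,u₂)` permissible — what
`IsPrepRecentring` and the choice of the move supply).
-/

set_option linter.dupNamespace false -- mandated namespace of this single-conjunct summit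

noncomputable section

namespace Summit.ResolutionOfSingularities.ResolutionOfSingularities.Theorems

namespace TOT2Curve

open MvPowerSeries PolyDescent MonicDescent WildMonic Literature.AlgebraicGeometry.Resolution

variable {k : Type} [Field k] {d : ℕ}

/-- Re-shearing a second branch: in the coordinates `ũ₂ = u₂ + u₁h` the branch `V(y + ψ₂, u₂ + u₁h₂)` has datum `h₂ − h`. -/
theorem isPermissibleTwoT_graph_reshear (A : Fin d → MvPowerSeries (Fin 2) k) (h h₂ ψ₂ : MvPowerSeries (Fin 2) k)
    (hh : ∀ e : Fin 2 →₀ ℕ, e 1 ≠ 0 → coeff e h = 0) (hperm₂ : IsPermissibleTwoT d (shift d (shearT h₂ A) ψ₂)) :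
    IsPermissibleTwoT d (shift d (shearT (h₂ - h) (shearT h A)) ψ₂) := by
  have hcomp : shearT (h₂ - h) (shearT h A) = shearT h₂ A := by
    funext j
    show shear (h₂ - h) (shear h (A j)) = shear h₂ (A j)
    rw [shear_shear_of_noY _ _ _ hh, sub_add_cancel]
  rwa [hcomp]

/-- **(F7) SECOND BRANCHES UNDER THE GRAPH-CURVE MOVE.**  Let `A` carry two permissible graph branches with `u₁`-only data `h ≠ h₂`, and let
`ψ₀` (`ψ₀(0) = 0`) re-centre the `h`-sheared label to a position for which `V(y,u₂)` — the first branch — is permissible (the centre of the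
move).  Then after the move, `divTwoT d (shift d (shearT h A) ψ₀)` carries a permissible graph branch with datum `h₂ − h`. -/
theorem graph_graphMove (hd : 0 < d) (A : Fin d → MvPowerSeries (Fin 2) k) (h h₂ ψ₂ ψ₀ : MvPowerSeries (Fin 2) k)
    (hh : ∀ e : Fin 2 →₀ ℕ, e 1 ≠ 0 → coeff e h = 0) (hh₂ : ∀ e : Fin 2 →₀ ℕ, e 1 ≠ 0 → coeff e h₂ = 0) (hne : h₂ ≠ h)
    (hperm₂ : IsPermissibleTwoT d (shift d (shearT h₂ A) ψ₂))
    (hpos : IsPosT d (shift d (shearT h A) ψ₀)) (hperm : IsPermissibleTwoT d (shift d (shearT h A) ψ₀)) :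
    ∃ ψ' : MvPowerSeries (Fin 2) k, constantCoeff ψ' = 0 ∧
      IsPermissibleTwoT d (shift d (shearT (h₂ - h) (divTwoT d (shift d (shearT h A) ψ₀))) ψ') := by
  have h1 := isPermissibleTwoT_graph_reshear A h h₂ ψ₂ hh hperm₂
  have h2 := isPermissibleTwoT_graph_recentre (h₂ - h) (shearT h A) ψ₂ ψ₀ h1
  have hdat : ∀ e : Fin 2 →₀ ℕ, e 1 ≠ 0 → coeff e (h₂ - h) = 0 := fun e he => by rw [map_sub, hh₂ e he, hh e he, sub_zero]
  exact graph_divTwoT hd _ hpos hperm (h₂ - h) _ hdat (sub_ne_zero.mpr hne) h2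

/-- (F7) for the predicate `HasGraphCurveT`. -/
theorem hasGraphCurveT_graphMove (hd : 0 < d) (A : Fin d → MvPowerSeries (Fin 2) k) (h h₂ ψ₂ ψ₀ : MvPowerSeries (Fin 2) k)
    (hh : ∀ e : Fin 2 →₀ ℕ, e 1 ≠ 0 → coeff e h = 0) (hh₂ : ∀ e : Fin 2 →₀ ℕ, e 1 ≠ 0 → coeff e h₂ = 0) (hne : h₂ ≠ h)
    (hperm₂ : IsPermissibleTwoT d (shift d (shearT h₂ A) ψ₂))
    (hpos : IsPosT d (shift d (shearT h A) ψ₀)) (hperm : IsPermissibleTwoT d (shift d (shearT h A) ψ₀)) :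
    HasGraphCurveT d (divTwoT d (shift d (shearT h A) ψ₀)) := by
  obtain ⟨ψ', hψ', hperm'⟩ := graph_graphMove hd A h h₂ ψ₂ ψ₀ hh hh₂ hne hperm₂ hpos hperm
  exact ⟨h₂ - h, ψ', fun e he => by rw [map_sub, hh₂ e he, hh e he, sub_zero], hψ', hperm'⟩

end TOT2Curve

end Summit.ResolutionOfSingularities.ResolutionOfSingularities.Theorems

end
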